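import Literature.Analysis.FunctionSpaces.BesselBoundaryProofs
import HarnessLib

/-!
# The zero set of a Bessel process of dimension `δ > 1` is Lebesgue-null (proofs)

Topic `Analysis/FunctionSpaces`; proof file of the named fact
`Literature.Analysis.FunctionSpaces.IsBesselProcess.ae_pos_of_ae_restrict_Ioi` of
`BesselBoundary.lean` (Revuz–Yor, Ch. XI, Prop. (1.5) and its proof, p. 442: "the time spent by
`X` in `0` has zero Lebesgue measure"; remark (ii) p. 442 for `δ ≥ 2`, where `{0}` is polar),
discharged here as `IsBesselProcess.ae_pos_of_ae_restrict_Ioi_holds`: on the canonical space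
`(ℝ≥0 → ℝ, preWienerMeasure)` with the canonical Brownian motion `B = brownian` and its raw
filtration, for `δ > 1`, `x₀ ≥ 0` and every Bessel process `ρ = √Z`, `Z = BESQ^δ(x₀²)`
(`IsBesselProcess`: `Z` a solution adapted to the raw filtration of `dZ = δ dt + 2√|Z| dB`,
`Z₀ = x₀²`), almost surely `ρ_s > 0` for Lebesgue-a.e. `s > 0`. Sibling of
`BesselBoundaryProofs.lean` (the Bessel equation
`√Z_t = √z₀ + B_t + ((δ-1)/2) ∫₀ᵗ (√Z_s)⁻¹ ds`, `IsSquaredBesselProcess.ae_sqrt_eq_sqrt_add_integral_inv`)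
and `BesselSDEFromZero.lean`.

## The proof

Revuz–Yor prove Prop. (1.5) with local times (Tanaka's formula `L⁰_t = 2δ ∫₀ᵗ 𝟙_{X_s = 0} ds`
against the occupation times formula), which the tree does not have. Here the null zero set is
read off the two Itô decompositions of `Z` that the tree HAS proved, by comparing drifts — the
elementary core of Revuz–Yor's argument (`δ · Leb{s ≤ t : Z_s = 0}` is the drift accumulated
on the zero set):

1. the squared Bessel equation itself, `Z_t = z₀ + δ t + J_t`, `J = ∫ 2√|Z| dB`
   (`IsSquaredBesselProcess`);
2. Itô's formula (`ito_formula_itoProcess_ae_holds`, `f(x) = x²`) along the Bessel process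
   `√Z`, which by the Bessel equation (`IsSquaredBesselProcess.ae_sqrt_eq_sqrt_add_integral_inv`,
   `δ > 1`) is an Itô process with drift `((δ-1)/2) (√Z)⁻¹` (a.s. locally integrable) and
   diffusion coefficient `1` (`∫ 1 dB = B`, `isItoIntegral_const_brownian`); the Itô integral
   of `σ f'(√Z) = 2√Z` may be taken to be the same `J` (`Z ≥ 0`,
   `IsSquaredBesselProcess.ae_nonneg`, `IsItoIntegral.congr_integrand_ae`), so that, a.s. for
   all `t`, `Z_t = (√Z_t)² = z₀ + ∫₀ᵗ ((δ-1) (√Z_s)⁻¹ √Z_s + 1) ds + J_t`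
   `= z₀ + ∫₀ᵗ (δ - (δ-1) 𝟙_{Z_s = 0}) ds + J_t` (Lean's `0⁻¹ = 0`; `itoDrift_sq_sqrt`);
3. subtracting, `(δ - 1) Leb{s ∈ (0, t] : Z_s = 0} = 0` for all `t`, a.s.
   (`IsSquaredBesselProcess.ae_pos_ae_restrict_Ioi`), and `√z > 0 ↔ z > 0`.

This covers every `δ > 1` at once. What is NOT here: the case `0 < δ ≤ 1` of Prop. (1.5)
(instantaneous reflection; for `δ = 1` the drift comparison is void and local times are needed).

## References

* D. Revuz, M. Yor, *Continuous Martingales and Brownian Motion* (3rd ed., 1999), Ch. XI, §1: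
  Prop. (1.5) and its proof, remarks (i)–(ii) after Cor. (1.4) (p. 442); Def. (1.9) (p. 445);
  Exercise (1.26) 1°) (p. 450); Ch. IV, Thm (3.3) (Itô's formula).
-/

noncomputable section

open MeasureTheory Filter Set
open scoped NNReal ENNReal Topology

namespace Literature.Analysis.FunctionSpaces

open Literature.Probability.Process Literature.Probability.RandomPlanarGeometry

/-! ### The Itô drift of `(√z)²` along the Bessel equation -/

/-- `(x²)' = 2x` at `y`, in Mathlib's `deriv` form used by `ito_formula_itoProcess_ae`.
[folklore] -/
theorem deriv_sq_apply (y : ℝ) : deriv (fun x : ℝ ↦ x ^ 2) y = 2 * y := by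
  rw [deriv_pow_field]
  simp

/-- **The Itô drift of `f(√z) = (√z)²` along the Bessel equation** (drift `((δ-1)/2) (√z)⁻¹`,
diffusion coefficient `1`, `f(x) = x²`): `∂ₜ f + ((δ-1)/2) (√z)⁻¹ f'(√z) + ½ · 1² · f''(√z)
= (δ - 1) (√z)⁻¹ √z + 1 = δ - (δ - 1) 𝟙_{√z = 0}` (Lean's `0⁻¹ = 0`). Comparing with the
drift `δ` of the squared Bessel equation is how the null zero set is obtained below.
Revuz–Yor, *Continuous Martingales and Brownian Motion* (1999), Ch. XI, proof of Prop. (1.5)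
(p. 442). [folklore] -/
theorem itoDrift_sq_sqrt (δ r z : ℝ) :
    deriv (fun _ : ℝ ↦ Real.sqrt z ^ 2) r +
        (δ - 1) / 2 * (Real.sqrt z)⁻¹ * deriv (fun x : ℝ ↦ x ^ 2) (Real.sqrt z) +
        2⁻¹ * (1 : ℝ) ^ 2 * iteratedDeriv 2 (fun x : ℝ ↦ x ^ 2) (Real.sqrt z) =
      δ - (δ - 1) * (if Real.sqrt z = 0 then 1 else 0) := by
  -- `(x²)'' = 2` (cf. `ItoFormulaCounterexample.iteratedDeriv_two_sq`)
  have h2 : iteratedDeriv 2 (fun x : ℝ ↦ x ^ 2) (Real.sqrt z) = 2 := by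
    rw [iteratedDeriv_succ, iteratedDeriv_one]
    have : deriv (fun x : ℝ ↦ x ^ 2) = fun y ↦ 2 * y := funext deriv_sq_apply
    rw [this, deriv_const_mul _ differentiableAt_id, deriv_id'', mul_one]
  rw [deriv_const, deriv_sq_apply, h2]
  by_cases h : Real.sqrt z = 0
  · rw [if_pos h, h]; ring
  · rw [if_neg h]
    field_simp
    ring

/-! ### The zero set of `BESQ^δ(z₀)`, `δ > 1`, is null -/

variable {δ z₀ : ℝ} {Z : ℝ≥0 → (ℝ≥0 → ℝ) → ℝ}

/-- **The zero set of a squared Bessel process `BESQ^δ(z₀)`, `δ > 1`, `z₀ ≥ 0`, is a.s.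
Lebesgue-null**: for a solution `Z` of `dZ = δ dt + 2√|Z| dB`, `Z₀ = z₀`, driven by the canonical
Brownian motion and adapted to its raw filtration, almost surely `Z_s > 0` for Lebesgue-a.e.
`s > 0`. Revuz–Yor: "the time spent by `X` in `0` has zero Lebesgue measure" (proof of
Prop. (1.5), `0 < δ < 2`, via `L⁰_t(X) = 2δ ∫₀ᵗ 𝟙_{X_s = 0} ds` and the occupation times
formula); "for `δ ≥ 2`, the set `{0}` is polar" ((ii) p. 442). Proof here, for all `δ > 1` at
once and without local times: by the Bessel equation
(`IsSquaredBesselProcess.ae_sqrt_eq_sqrt_add_integral_inv`) the process `√Z` is an Itô process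
with drift `((δ-1)/2) (√Z)⁻¹` and diffusion coefficient `1`; Itô's formula
(`ito_formula_itoProcess_ae_holds`) for `(√Z)² = Z`, with the Itô integral `J = ∫ 2√|Z| dB` of
the squared Bessel equation, gives `Z_t = z₀ + ∫₀ᵗ (δ - (δ-1) 𝟙_{Z_s = 0}) ds + J_t`
(`itoDrift_sq_sqrt`), while the equation says `Z_t = z₀ + δ t + J_t`; hence
`(δ - 1) Leb{s ∈ (0, n] : Z_s = 0} = 0` for every `n`.
[cite: RevuzYor1999, Ch. XI Prop. (1.5) (p. 442)] -/
theorem IsSquaredBesselProcess.ae_pos_ae_restrict_Ioi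
    (hZ : IsSquaredBesselProcess δ z₀ Z brownian brownianFiltration preWienerMeasure)
    (hδ : 1 < δ) (hz₀ : 0 ≤ z₀) :
    ∀ᵐ ω ∂preWienerMeasure, ∀ᵐ s ∂(volume.restrict (Ioi (0 : ℝ))), 0 < Z s.toNNReal ω := by
  have hδ0 : 0 ≤ δ := by linarith
  have hnn : ∀ᵐ ω ∂preWienerMeasure, ∀ s, 0 ≤ Z s ω := hZ.ae_nonneg hδ0 hz₀
  have hBE := hZ.ae_sqrt_eq_sqrt_add_integral_inv hδ hz₀
  have hcont := IsStrongSolution.ae_continuous hZ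
  obtain ⟨hZ0, hZa, -, J, hJ, heq⟩ := hZ
  -- the Bessel process `√Z` is an Itô process with drift `((δ-1)/2) (√Z)⁻¹` and diffusion `1`
  have hXa : Adapted brownianFiltration fun t ω ↦ Real.sqrt (Z t ω) := fun i ↦ (hZa i).sqrt
  have hX : IsItoProcess (fun t ω ↦ Real.sqrt (Z t ω))
      (fun s ω ↦ (δ - 1) / 2 * (Real.sqrt (Z s ω))⁻¹) (fun _ _ ↦ (1 : ℝ))
      brownian brownianFiltration preWienerMeasure := by
    refine ⟨?_, fun t ω ↦ 1 * brownian t ω, isItoIntegral_const_brownian 1, ?_⟩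
    · filter_upwards [hBE] with ω hω t
      exact ((intervalIntegrable_iff_integrableOn_Icc_of_le t.coe_nonneg).1 (hω t).1).const_mul _
    · filter_upwards [hBE] with ω hω t
      rw [(hω t).2, hZ0 ω, intervalIntegral.integral_const_mul, one_mul]
      ring
  have hσp : IsStronglyProgressive brownianFiltration (fun (_ : ℝ≥0) (_ : ℝ≥0 → ℝ) ↦ (1 : ℝ)) :=
    isStronglyProgressive_const _ (1 : ℝ)
  -- the Itô integral of `σ f'(√Z) = 2√Z`, `f = (·)²`, is the `J = ∫ 2√|Z| dB` of the equation
  have hJ' : IsItoIntegral (fun t ω ↦ (1 : ℝ) * deriv (fun x : ℝ ↦ x ^ 2) (Real.sqrt (Z t ω)))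
      brownian J brownianFiltration preWienerMeasure := by
    refine hJ.congr_integrand_ae ?_
    filter_upwards [hnn] with ω hω t
    rw [deriv_sq_apply, one_mul, abs_of_nonneg (hω t)]
  have hf2 : ContDiff ℝ 2 (Function.uncurry fun (_ : ℝ) (x : ℝ) ↦ x ^ 2) := contDiff_snd.pow 2
  have hI := ito_formula_itoProcess_ae_holds (fun (_ : ℝ) (x : ℝ) ↦ x ^ 2) hf2 hXa hσp hX hJ'
  -- comparison of the drifts of `Z = (√Z)²` (Itô) and of `Z` (the equation) on `(0, n]`
  have hIoc : ∀ n : ℕ, ∀ᵐ ω ∂preWienerMeasure,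
      ∀ᵐ s ∂(volume.restrict (Set.Ioc (0 : ℝ) n)), 0 < Z s.toNNReal ω := by
    intro n
    have hn0 : (0 : ℝ) ≤ ((n : ℝ≥0) : ℝ) := NNReal.coe_nonneg _
    filter_upwards [hI, heq, hnn, hcont] with ω hIω heqω hω hc
    have h1 := hIω (n : ℝ≥0)
    have h2 := heqω (n : ℝ≥0)
    have hdrift : (∫ s in (0 : ℝ)..((n : ℝ≥0) : ℝ),
        (deriv (fun _ : ℝ ↦ Real.sqrt (Z s.toNNReal ω) ^ 2) (s.toNNReal : ℝ) +
          (δ - 1) / 2 * (Real.sqrt (Z s.toNNReal ω))⁻¹ *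
            deriv (fun x : ℝ ↦ x ^ 2) (Real.sqrt (Z s.toNNReal ω)) +
          2⁻¹ * (1 : ℝ) ^ 2 * iteratedDeriv 2 (fun x : ℝ ↦ x ^ 2) (Real.sqrt (Z s.toNNReal ω)))) =
        ∫ s in (0 : ℝ)..((n : ℝ≥0) : ℝ),
          (δ - (δ - 1) * if Real.sqrt (Z s.toNNReal ω) = 0 then (1 : ℝ) else 0) :=
      intervalIntegral.integral_congr fun s _ ↦ itoDrift_sq_sqrt δ _ _
    have hsq : ∀ t, Real.sqrt (Z t ω) ^ 2 = Z t ω := fun t ↦ Real.sq_sqrt (hω t)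
    rw [hdrift, hsq, hsq] at h1
    -- the indicator of the zero set is integrable on `(0, n]` (the path is continuous)
    have hZpath : Continuous fun s : ℝ ↦ Z s.toNNReal ω := hc.comp continuous_real_toNNReal
    have hImeas : Measurable fun s : ℝ ↦ if Real.sqrt (Z s.toNNReal ω) = 0 then (1 : ℝ) else 0 :=
      Measurable.ite (measurableSet_eq_fun hZpath.measurable.sqrt measurable_const)
        measurable_const measurable_const
    have hI0 : ∀ s : ℝ, 0 ≤ (if Real.sqrt (Z s.toNNReal ω) = 0 then (1 : ℝ) else 0) := fun s ↦ by
      split_ifs <;> norm_num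
    have hI1 : ∀ s : ℝ, ‖(if Real.sqrt (Z s.toNNReal ω) = 0 then (1 : ℝ) else 0)‖ ≤ 1 := fun s ↦ by
      split_ifs <;> simp
    have hIint' : IntegrableOn (fun s : ℝ ↦ if Real.sqrt (Z s.toNNReal ω) = 0 then (1 : ℝ) else 0)
        (Set.Ioc (0 : ℝ) ((n : ℝ≥0) : ℝ)) volume :=
      Measure.integrableOn_of_bounded (M := 1) measure_Ioc_lt_top.ne hImeas.aestronglyMeasurable
        (ae_of_all _ hI1)
    have hIint : IntervalIntegrable
        (fun s : ℝ ↦ if Real.sqrt (Z s.toNNReal ω) = 0 then (1 : ℝ) else 0) volume 0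
          ((n : ℝ≥0) : ℝ) :=
      (intervalIntegrable_iff_integrableOn_Ioc_of_le hn0).2 hIint'
    -- `(δ - 1) ∫₀ⁿ 𝟙_{√Z = 0} ds = 0`
    have h3 : (∫ s in (0 : ℝ)..((n : ℝ≥0) : ℝ),
        (δ - (δ - 1) * if Real.sqrt (Z s.toNNReal ω) = 0 then (1 : ℝ) else 0)) =
          ∫ _ in (0 : ℝ)..((n : ℝ≥0) : ℝ), δ := by
      linarith
    rw [intervalIntegral.integral_sub intervalIntegrable_const (hIint.const_mul _),
      intervalIntegral.integral_const_mul] at h3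
    have h4 : (∫ s in (0 : ℝ)..((n : ℝ≥0) : ℝ),
        if Real.sqrt (Z s.toNNReal ω) = 0 then (1 : ℝ) else 0) = 0 := by
      have h5 : (δ - 1) * ∫ s in (0 : ℝ)..((n : ℝ≥0) : ℝ),
          (if Real.sqrt (Z s.toNNReal ω) = 0 then (1 : ℝ) else 0) = 0 := by
        linarith
      exact (mul_eq_zero.1 h5).resolve_left (by linarith)
    rw [intervalIntegral.integral_of_le hn0] at h4
    have hae := (integral_eq_zero_iff_of_nonneg hI0 hIint').1 h4
    rw [NNReal.coe_natCast] at hae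
    filter_upwards [hae] with s hs
    have hs' : Real.sqrt (Z s.toNNReal ω) ≠ 0 := by
      intro h0
      simp [h0] at hs
    have hne : Z s.toNNReal ω ≠ 0 := fun h ↦ hs' (by rw [h, Real.sqrt_zero])
    exact lt_of_le_of_ne (hω _) hne.symm
  -- `(0, ∞) = ⋃ₙ (0, n]`
  filter_upwards [ae_all_iff.2 hIoc] with ω hω
  have hsub : Ioi (0 : ℝ) ⊆ ⋃ n : ℕ, Set.Ioc (0 : ℝ) n := fun s hs ↦ by
    obtain ⟨n, hn⟩ := exists_nat_ge s
    exact Set.mem_iUnion.2 ⟨n, hs, hn⟩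
  exact ae_restrict_of_ae_restrict_of_subset hsub ((ae_restrict_iUnion_iff _ _).2 hω)

/-- **Discharge of the named fact `IsBesselProcess.ae_pos_of_ae_restrict_Ioi`** (the zero set
of a Bessel process of dimension `δ > 1` is Lebesgue-null, on the canonical space): for `δ > 1`,
`x₀ ≥ 0` and every Bessel process `ρ = √Z`, `Z = BESQ^δ(x₀²)` driven by the canonical Brownian
motion (`IsBesselProcess`), almost surely `ρ_s > 0` for Lebesgue-a.e. `s > 0` — from
`IsSquaredBesselProcess.ae_pos_ae_restrict_Ioi` (`z₀ = x₀² ≥ 0`) and `√z > 0 ↔ z > 0`.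
Revuz–Yor, Ch. XI, Prop. (1.5) and its proof, p. 442 ("the time spent by `X` in `0` has zero
Lebesgue measure", `0 < δ < 2`) and remark (ii) p. 442 ("for `δ ≥ 2`, the set `{0}` is polar");
only the range `δ > 1` is vendored by the fact, and it is proved here for all `δ > 1` at once.
[cite: RevuzYor1999, Ch. XI Prop. (1.5) (p. 442)] -/
theorem IsBesselProcess.ae_pos_of_ae_restrict_Ioi_holds :
    IsBesselProcess.ae_pos_of_ae_restrict_Ioi := by
  intro δ x₀ ρ hδ _ hρ
  obtain ⟨Z, hZ, hρZ⟩ := hρ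
  filter_upwards [hZ.ae_pos_ae_restrict_Ioi hδ (sq_nonneg x₀)] with ω hω
  filter_upwards [hω] with s hs
  rw [hρZ]
  exact Real.sqrt_pos.2 hs

end Literature.Analysis.FunctionSpaces

end
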